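import Literature.AlgebraicGeometry.Resolution.PointBlowupShadeCentres
import Mathlib.Algebra.MvPolynomial.PDeriv
import Mathlib.Algebra.MvPolynomial.Division

/-!
# The adapted numbers `(H, ε, ω)` of Cossart–Piltant on the point-blowup walk (statement-level typing)

`PointBlowupShade` types Hauser's walk for `h = x^q + F(y)` — states `(F, r)`, one `step` at the
point `b` of the chart `y_j`, and the classical pair `(order, shade)`.  This file adds, at the
same statement level and in the SAME given coordinates, the boundary-adapted numbers of
[Cossart–Piltant 2019, ch. 2] in their case `G = 0` (purely inseparable initial form
`in_{m_S} h = Z^p + F_{p,Z}`, `i₀(x) = p`), for a boundary `E` = a set of coordinate hyperplanes: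

* `bigH F j = min {d j : d ∈ supp F}` — `H_j = p·d_j` for `j ∈ E` (Def. 2.10 with Prop. 2.8:
  `d_j = min {a_j / i}`; only `i = p` occurs for `h = Z^p + F`);
* `epsilon E s = ord₀ F − Σ_{j∈E} H_j` — `ε(x) = p δ(x) − Σ_j H_j` (Def. 2.10, introduction (1.8));
* `F_{p,Z}` = `HauserPerlega2019.initialForm F`, the lowest-degree form of `F` (Thm. 2.14 (1); the tree's
  definition from `PointBlowupShadeCentres` is reused);
* `VNonzero E F` — `V(F_{p,Z},E,m_S) ≠ 0 ⟺ ∂F_{p,Z}/∂U_j ≠ 0` for some `j ∉ E` (Prop. 2.16 (i));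
* `omega E s` — `ω(x) = ε(x) − 1` if `V ≠ 0`, `ω(x) = ε(x)` otherwise (Def. 2.16, `G = 0`; (1.10));
  in this case `κ(x) ≥ 2` ALWAYS — Def. 2.16 sets `κ(x) := 1` only if `ω(x) = ε(x)` AND `i₀(x) = p − 1`
  (`G ≠ 0`), so both clauses of Thm. 3.6 apply to every state typed here; `OmegaEqEpsilon` is the
  case split `ω = ε` / `ω = ε − 1` that selects the cone in Def. 2.17;
* `newBoundary j b E` — `E'` at the point: the new exceptional component and the strict transforms
  of the old ones through the point (Prop. 2.13; "`E' := σ⁻¹(E)_red`", p. 34, read at its stalk at `s'`);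
* the edge predicates `OmegaIncreases / OmegaStalls / OmegaDrops` of a step read with boundary;
* the cone `Max(x)` (Def. 2.13, Prop. 2.16: `Max(V(F_{p,Z},E))` if `ω = ε − 1`, `Max(J(F_{p,Z},E))`
  if `ω = ε`), membership `G(U + v) = G(U)`, and `OnAdaptedCone E s v`;
* the directrix membership of [CJS 2020, Def. 3.13 / Thm. 3.14] for `ord₀ F = p`: the point of
  `P(C_x X)` above the direction `v` is `(c : v)` with `c^p = −F_{p,Z}(v)`, and `(c, v)` leaves
  `Z^p + F_{p,Z}` translation invariant iff `F_{p,Z}(U + v) = F_{p,Z}(U) + F_{p,Z}(v)` (`AdditiveAlong`);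
* the row-wise TEST predicates `NoOmegaIncreaseAt` (Thm. 3.6, first clause), `StallOnConeAt`
  (Thm. 3.6, second clause with `κ(x) ≥ 2`), `NearOnDirectrixAt` (CJS Thm. 3.14), which the atlas
  evaluates edge by edge.  They are PREDICATES on one step, never asserted: the published theorems
  carry hypotheses (well adapted coordinates, condition **(E)**, `ω(x) > 0`, `m(x) = p`, and for
  CJS `char k(x) ≥ dim X / 2 + 1`) whose identification with the atlas' cleaned coordinates is a
  recorded convention of the atlas, not a theorem of this file.

What is NOT here: the case `G ≠ 0` (`i₀ = p − 1`, truncation operator `T`, Def. 2.14–2.16), the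
projection number `κ(x) ∈ {2,3,4}` of ch. 4–6, condition (E) itself (a statement about
`Sing_p 𝒳`), and any claim that `ι = (m, ω, κ)` decreases.  The computable twin with kernel-checked
rows is `KangarooAtlasCertAdaptedOrder`.
-/

noncomputable section

open MvPolynomial Finset

open scoped BigOperators

namespace Literature.AlgebraicGeometry.Resolution

open Literature.AlgebraicGeometry.Resolution.Hauser2010
open Literature.AlgebraicGeometry.Resolution.HauserPerlega2019 (initialForm)

namespace PointBlowup

variable {σ : Type*} {K : Type*} [CommRing K]

/-! ### `H`, `ε`, `F_{p,Z}`, `V ≠ 0`, `ω` -/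

/-- `H_j := min {d_j : d ∈ supp F}` (`⊤` for `F = 0`): for `h = Z^p + F` in well adapted
coordinates and `div(u_j) ⊆ E`, `H_j = p·d_j` with `d_j = min{a_j / p : a ∈ supp F}`
(Prop. 2.8 applied to `f_{p,Z} = F`, `f_{i,Z} = 0` for `i < p`). [cite: CossartPiltant2019, Def. 2.10] -/
def bigH (F : MvPolynomial σ K) (j : σ) : ℕ∞ :=
  F.support.inf fun d => ((d j : ℕ) : ℕ∞)

/-- `ε(x) := p δ(x) − Σ_{div(u_j) ⊆ E} H_j = ord₀ F − Σ_{j ∈ E} H_j` (`deg in_{m_S} h = p δ(x) = ord₀ F_{p,Z}`).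
`ℕ∞` subtraction; `⊤` for `F = 0`. [cite: CossartPiltant2019, Def. 2.10] -/
def epsilon (E : Finset σ) (s : State σ K) : ℕ∞ :=
  ordZero s.F - ∑ j ∈ E, bigH s.F j

/-- `V(F_{p,Z},E,m_S) ≠ 0`: "`V(F_{p,Z},E,m_S) = 0 ⟺ F_{p,Z} ∈ k[U₁,…,U_e][U_{e+1}^p,…,U_n^p]`",
i.e. `V ≠ 0` iff `∂F_{p,Z}/∂U_j ≠ 0` for some `j ∉ E` (in characteristic `p` the partial
derivative kills exactly the exponents `≡ 0 mod p`). [cite: CossartPiltant2019, Prop. 2.16] -/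
def VNonzero (E : Finset σ) (F : MvPolynomial σ K) : Prop :=
  ∃ j, j ∉ E ∧ pderiv j (initialForm F) ≠ 0

/-- Cossart–Piltant's **adapted order** in the case `G = 0`:
`ω(x) := ε(x)` if `∂F_{p,Z}/∂U_j = 0` for `e + 1 ≤ j ≤ n`, and `ω(x) := ε(x) − 1` otherwise
("the function `ω` is a differential version of Hironaka's `ε`-function"). [cite: CossartPiltant2019, Def. 2.16] -/
def omega (E : Finset σ) (s : State σ K) : ℕ∞ :=
  haveI := Classical.dec (VNonzero E s.F)
  if VNonzero E s.F then epsilon E s - 1 else epsilon E s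

/-- The case `ω(x) = ε(x)` (i.e. `V(F_{p,Z},E,m_S) = 0`) of the split in Def. 2.16 / 2.17, which selects
the cone `Max(J(…))` instead of `Max(V(…))`.  NOTE on `κ`: "`κ(x) := 1` if (`ω(x) = ε(x)` and
`i₀(x) = p − 1`). Otherwise, we simply let `κ(x) ≥ 2`" — so in the case `G = 0` (`i₀(x) = p`) typed in
this file `κ(x) ≥ 2` always, whether or not `ω = ε`; the finer projection number `κ(x) ∈ {2,3,4}` of
ch. 4 is not typed here. [cite: CossartPiltant2019, Def. 2.16] -/
def OmegaEqEpsilon (E : Finset σ) (s : State σ K) : Prop := ¬ VNonzero E s.F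

/-- in the case `ω = ε` the two numbers agree. [cite: CossartPiltant2019, Def. 2.16] -/
theorem omega_eq_epsilon_of (E : Finset σ) (s : State σ K) (h : OmegaEqEpsilon E s) :
    omega E s = epsilon E s := by
  unfold omega
  rw [if_neg h]

/-- `ω ≤ ε`. [cite: CossartPiltant2019, Def. 2.16] -/
theorem omega_le_epsilon (E : Finset σ) (s : State σ K) : omega E s ≤ epsilon E s := by
  unfold omega
  split_ifs
  · exact tsub_le_self
  · exact le_rfl

/-! ### The boundary along the walk -/

/-- Hauser's bookkeeping read as a boundary: the components of `D = {y^r = 0}` through the point,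
`E_r := supp r`. [cite: Hauser2010, §F (setting f = x^p + y^r g)] -/
def multBoundary (r : σ →₀ ℕ) : Finset σ := r.support

/-- The boundary at the point `b` of the chart `y_j`: `E' = {j} ∪ {i ∈ E : i ≠ j, b_i = 0}` — the
new exceptional component `{y_j = 0}` together with the strict transforms of the old components
passing through the point ("`E' := σ⁻¹(E)_red`", the reduced total transform, read at its stalk at the point).
[cite: CossartPiltant2019, Prop. 2.13] -/
def newBoundary [DecidableEq σ] [DecidableEq K] (j : σ) (b : σ → K) (E : Finset σ) : Finset σ :=
  insert j (E.filter fun i => i ≠ j ∧ b i = 0)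

/-- the new component belongs to the new boundary. [folklore] -/
theorem mem_newBoundary [DecidableEq σ] [DecidableEq K] (j : σ) (b : σ → K) (E : Finset σ) :
    j ∈ newBoundary j b E :=
  mem_insert_self _ _

/-- Hauser's multiplicity support is transported INSIDE the boundary transport:
`supp r' ⊆ E'` whenever `supp r ⊆ E` (the new multiplicity `ord₀ F − q` may vanish, and an old
`r_i` may be `0`, so equality fails in general). [folklore] -/
theorem multBoundary_step_subset [DecidableEq σ] [DecidableEq K] (q : ℕ) (j : σ) (b : σ → K)
    (s : State σ K) (E : Finset σ) (hE : multBoundary s.r ⊆ E) :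
    multBoundary (step q j b s).r ⊆ newBoundary j b E := by
  intro i hi
  simp only [multBoundary, step, newMult, Finsupp.mem_support_iff] at hi
  simp only [newBoundary, mem_insert, mem_filter]
  by_cases hij : i = j
  · exact Or.inl hij
  · right
    rw [Finsupp.update_apply, if_neg hij, Finsupp.filter_apply] at hi
    split_ifs at hi with hb
    · exact ⟨hE (by simpa [multBoundary] using hi), hij, hb⟩
    · exact absurd rfl hi

/-! ### Edge predicates for `ω` -/

/-- `ω` **increases** at the point `b` of chart `y_j`, boundaries transported. [cite: CossartPiltant2019, Thm. 3.6] -/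
def OmegaIncreases [DecidableEq σ] [DecidableEq K] (q : ℕ) (j : σ) (b : σ → K) (E : Finset σ)
    (s : State σ K) : Prop :=
  omega E s < omega (newBoundary j b E) (step q j b s)

/-- `ω` **stalls** (`ω(x') = ω(x)`). [cite: CossartPiltant2019, Thm. 3.6] -/
def OmegaStalls [DecidableEq σ] [DecidableEq K] (q : ℕ) (j : σ) (b : σ → K) (E : Finset σ)
    (s : State σ K) : Prop :=
  omega (newBoundary j b E) (step q j b s) = omega E s

/-- `ω` **drops**. [cite: CossartPiltant2019, Thm. 3.6] -/
def OmegaDrops [DecidableEq σ] [DecidableEq K] (q : ℕ) (j : σ) (b : σ → K) (E : Finset σ)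
    (s : State σ K) : Prop :=
  omega (newBoundary j b E) (step q j b s) < omega E s

/-- The first clause of [CoP 2019, Thm. 3.6] READ AT ONE STEP of the walk (`q = p`): at a point
`x'` of the blow-up along `x` that is "very near" `x` (equimultiple, `ω(x') ≥ ω(x)`) one has
`ω(x') ≤ ω(x)` — so `ω` never increases; hypotheses of the theorem: `m(x) = p`, `ω(x) > 0`,
condition (E), well adapted coordinates on both sides. A predicate the atlas tests; not asserted. [cite: CossartPiltant2019, Thm. 3.6] -/
def NoOmegaIncreaseAt [DecidableEq σ] [DecidableEq K] (p : ℕ) (j : σ) (b : σ → K) (E : Finset σ)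
    (s : State σ K) : Prop :=
  IsEquimultiplePoint p j b s → 0 < omega E s → omega E s ≠ ⊤ → ¬ OmegaIncreases p j b E s

/-! ### The cone `Max(x)` and the directrix -/

/-- `v ∈ Max(G)` for a form `G`: `G(U + v) = G(U)` (the translation-invariance reading of
Hironaka's `Max`/ridge for a single form; cf. `invarianceSpace` in `HironakaDirectrix`). [cite: CossartPiltant2019, Def. 2.13] -/
def InMax (G : MvPolynomial σ K) (v : σ → K) : Prop :=
  translate v G = G

/-- the monomial exponent `H` restricted to `E` (as a finitely supported function; `toNat` of `bigH`). [cite: CossartPiltant2019, Def. 2.10] -/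
def bigHVec (E : Finset σ) (F : MvPolynomial σ K) : σ →₀ ℕ :=
  ∑ j ∈ E, Finsupp.single j (bigH F j).toNat

/-- Generators of the cone ideal at `x` (`G = 0`): `V(F_{p,Z},E) = H⁻¹⟨∂F_{p,Z}/∂U_j : j ∉ E⟩`
when `V ≠ 0` (`ω = ε − 1`), else `J(F_{p,Z},E) = H⁻¹⟨U_j ∂F_{p,Z}/∂U_j : j ∈ E⟩` (`ω = ε`;
the `λ_l`-derivatives of an imperfect residue field do not occur over a perfect field). [cite: CossartPiltant2019, Prop. 2.16] -/
def coneGens [DecidableEq σ] (E : Finset σ) (F : MvPolynomial σ K) :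
    Set (MvPolynomial σ K) :=
  haveI := Classical.dec (VNonzero E F)
  if VNonzero E F then
    {G | ∃ j, j ∉ E ∧ G = (pderiv j (initialForm F)).divMonomial (bigHVec E F)}
  else
    {G | ∃ j, j ∈ E ∧ G = (X j * pderiv j (initialForm F)).divMonomial (bigHVec E F)}

/-- `v ∈ Max(x)`: `v` leaves every cone generator translation invariant. [cite: CossartPiltant2019, Def. 2.17] -/
def OnAdaptedCone [DecidableEq σ] (E : Finset σ) (s : State σ K) (v : σ → K) : Prop :=
  ∀ G ∈ coneGens E s.F, InMax G v

/-- The direction `e_j + Σ_{i ≠ j} b_i e_i` of the point `b` of the chart `y_j`: the point `s'` of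
`σ⁻¹(m_S) = Proj k[U₁,…,U_n]` at which the equality clause "`s' ∈ PC(x,𝒴)`" of Thm. 3.6 is read
(atlas reading of the chart formulas). [cite: CossartPiltant2019, Thm. 3.6] -/
def direction [DecidableEq σ] (j : σ) (b : σ → K) : σ → K :=
  Function.update b j 1

/-- The second clause of [CoP 2019, Thm. 3.6] READ AT ONE STEP (`G = 0`, so `κ(x) ≥ 2` in both cases
`ω = ε`, `ω = ε − 1`): if
`ι(x') ≥ ι(x)` — on the walk: the point is equimultiple and `ω` stalls — then `x'` lies on
`Proj` of the cone `Max(x)`. A predicate the atlas tests; not asserted. [cite: CossartPiltant2019, Thm. 3.6] -/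
def StallOnConeAt [DecidableEq σ] [DecidableEq K] (p : ℕ) (j : σ) (b : σ → K) (E : Finset σ)
    (s : State σ K) : Prop :=
  IsEquimultiplePoint p j b s → 0 < omega E s → omega E s ≠ ⊤ → OmegaStalls p j b E s →
    OnAdaptedCone E s (direction j b)

/-- `Φ` is **additive along** `v`: `Φ(U + v) = Φ(U) + Φ(v)`. [folklore] -/
def AdditiveAlong (Φ : MvPolynomial σ K) (v : σ → K) : Prop :=
  translate v Φ = Φ + C (eval v Φ)

/-- The direction `v` lies in the directrix `Dir_x(X) ⊆ T_x(Z)` of `in(h) = Z^p + F_{p,Z}`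
(`ord₀ F = p`): the point `(c : v)` of `P(C_x X)` with `c^p = −F_{p,Z}(v)` is translation
invariant for `Z^p + F_{p,Z}` iff `F_{p,Z}` is additive along `v`
(`(Z + c)^p + F_{p,Z}(U + v) = Z^p + F_{p,Z}(U)` in characteristic `p`). [cite: CossartJannsenSaito2020, Def. 3.13] -/
def OnDirectrix (s : State σ K) (v : σ → K) : Prop :=
  AdditiveAlong (initialForm s.F) v

/-- [CJS 2020, Thm. 3.14] READ AT ONE STEP: if `x'` is near to `x` (same Hilbert–Samuel function;
for the hypersurface `Z^p + F`, `ord₀ F = p`: the point is `p`-fold again) then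
`x' ∈ P(Dir_x X)`, granted `char k(x) = 0` or `char k(x) ≥ dim X / 2 + 1`. A predicate the atlas
tests (also outside the characteristic hypothesis); not asserted. [cite: CossartJannsenSaito2020, Thm. 3.14] -/
def NearOnDirectrixAt [DecidableEq σ] [DecidableEq K] (p : ℕ) (j : σ) (b : σ → K) (s : State σ K) :
    Prop :=
  ordZero s.F = p → IsEquimultiplePoint p j b s → OnDirectrix s (direction j b)

end PointBlowup

end Literature.AlgebraicGeometry.Resolution

end
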